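import Literature.NumberTheory.EllipticCurves.CofreeTorsionFiniteness
import HarnessLib

/-!
# `𝒪/c𝒪` is finite for every non-zero `c` of the `p`-adic coefficient ring `𝒪 = padicCoeffIntegers ι` of a newform (proofs only)

Topic `NumberTheory/EllipticCurves` (namespace `Literature.NumberTheory.EllipticCurves.GreenbergSelmer`). THEOREMS ONLY (no definition,
no named fact; D-0026). Sequel of `CofreeTorsionFiniteness.lean` (`finite_padicCoeffIntegers_quotient_p`: `𝒪/p` finite; its two
private helpers are repeated here privately): for `𝒪 = {x ∈ ℚ_p(ι K_g) : |x|_p ≤ 1}` with `K = ℚ_p(ι K_g)` finite over `ℚ_p`,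
every quotient `𝒪/c𝒪`, `c ≠ 0`, is finite — `p^j = c · (p^j c⁻¹)` with `p^j c⁻¹ ∈ 𝒪` for large `j`
(`exists_pow_p_mul_mem_padicCoeffIntegers`), so `𝒪/c` is a quotient of `𝒪/p^j`, itself the image of `(ℤ_p/p^j)^s` for a finite
generating set `s` of the `ℤ_p`-module `𝒪` (`moduleFinite_padicCoeffIntegers`; `ℤ_p/p^j ≃ ℤ/p^j`, Mathlib `PadicInt.ker_toZModPow`).
Use: the finiteness `(F/𝒪)[c]` (`CofreeFrameCoordinatesProofs.finite_setOf_smul_quotient_eq_zero`) in the (FIX) triangular reduction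
of crux 25505 (cell `bsd-stepL`), with `c = δ(σ₁) − 1 ≠ 0`.

* `finite_padicCoeffIntegers_quotient_pow` — `𝒪/p^j` is finite;
* `finite_padicCoeffIntegers_quotient_span` — `𝒪/c` is finite for `c ≠ 0`.

References: [NeukirchANT1999] Ch. II (4.8), (6.8); [EmertonPollackWeston2006] §3.1 ("`𝒪` the ring of integers of `K`").
-/

noncomputable section

open scoped Classical

namespace Literature.NumberTheory.EllipticCurves.GreenbergSelmer

open Literature.NumberTheory.GaloisRepresentations Literature.NumberTheory.Automorphic
open Literature.NumberTheory.EllipticCurves.ModularForms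

/-- A map that factors through a surjection onto a finite type has finite range. [folklore] -/
private theorem finite_range_of_factors2 {X Q Y : Type*} [Finite Q] (π : X → Q)
    (hπ : Function.Surjective π) (ψ : X → Y) (h : ∀ x x', π x = π x' → ψ x = ψ x') :
    (Set.range ψ).Finite := by
  refine (Set.finite_range (ψ ∘ Function.surjInv hπ)).subset ?_
  rintro _ ⟨x, rfl⟩
  exact ⟨π x, h _ _ (Function.surjInv_eq hπ (π x))⟩


/-- **`𝒪/r𝒪` is finite** for an `R`-algebra `𝒪` that is finitely generated as an `R`-module, when
`R/rR` is finite: `𝒪/r𝒪` is the image of `(R/r)^s` for a finite generating set `s`. [folklore: Atiyah–Macdonald Prop. 2.17 style base change of finite generation] -/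
private theorem finite_quotient_span_algebraMap2 {R 𝒪 : Type*} [CommRing R] [CommRing 𝒪] [Algebra R 𝒪]
    [Module.Finite R 𝒪] (r : R) [Finite (R ⧸ Ideal.span {r})] :
    Finite (𝒪 ⧸ Ideal.span {algebraMap R 𝒪 r}) := by
  classical
  obtain ⟨s, hs⟩ := Module.Finite.fg_top (R := R) (M := 𝒪)
  let ψ : (s → R) → 𝒪 ⧸ Ideal.span {algebraMap R 𝒪 r} := fun c ↦
    Ideal.Quotient.mk _ (∑ i, c i • (i : 𝒪))
  let π : (s → R) → (s → R ⧸ Ideal.span {r}) := fun c i ↦ Ideal.Quotient.mk _ (c i)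
  have hπ : Function.Surjective π := fun q ↦ by
    choose c hc using fun i ↦ Ideal.Quotient.mk_surjective (q i)
    exact ⟨c, funext hc⟩
  have hψ : ∀ c c', π c = π c' → ψ c = ψ c' := by
    intro c c' hcc'
    have hd : ∀ i, ∃ d : R, d * r = c i - c' i := fun i ↦
      Ideal.mem_span_singleton'.1 (Ideal.Quotient.eq.1 (congrFun hcc' i))
    choose d hd using hd
    refine Ideal.Quotient.eq.2 (Ideal.mem_span_singleton'.2 ⟨∑ i, d i • (i : 𝒪), ?_⟩)
    rw [← Finset.sum_sub_distrib, Finset.sum_mul]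
    refine Finset.sum_congr rfl fun i _ ↦ ?_
    rw [← sub_smul, ← hd i, mul_comm (d i) r, mul_smul, Algebra.smul_def r, smul_mul_assoc, mul_comm]
    exact (mul_smul_comm _ _ _).symm
  have hsurj : Set.range ψ = Set.univ := by
    refine Set.eq_univ_of_forall fun z ↦ ?_
    obtain ⟨o, rfl⟩ := Ideal.Quotient.mk_surjective z
    have ho : o ∈ Submodule.span R (Set.range (Subtype.val : s → 𝒪)) := by
      rw [Subtype.range_coe_subtype, Finset.setOf_mem, hs]; trivial
    obtain ⟨c, hc⟩ := (Submodule.mem_span_range_iff_exists_fun R).1 ho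
    exact ⟨c, by simp only [ψ, hc]⟩
  have hfin := finite_range_of_factors2 π hπ ψ hψ
  rw [hsurj] at hfin
  exact Set.finite_univ_iff.1 hfin


/-- **`ℤ_p/p^j ℤ_p` is finite** (`≃ ℤ/p^j` through Mathlib `PadicInt.toZModPow`, kernel `(p^j)`). [folklore] -/
private theorem finite_padicInt_quotient_pow (p : ℕ) [Fact p.Prime] (j : ℕ) :
    Finite (ℤ_[p] ⧸ Ideal.span {(p : ℤ_[p]) ^ j}) := by
  have hker : Ideal.span {(p : ℤ_[p]) ^ j} = RingHom.ker (PadicInt.toZModPow j : ℤ_[p] →+* ZMod (p ^ j)) :=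
    (PadicInt.ker_toZModPow j).symm
  exact Finite.of_equiv (ZMod (p ^ j)) ((Ideal.quotEquivOfEq hker).trans
    (RingHom.quotientKerEquivOfSurjective (ZMod.ringHom_surjective (PadicInt.toZModPow j)))).symm.toEquiv

section Padic

open scoped MatrixGroups ModularForm
open CongruenceSubgroup

variable {Γ : Subgroup (GL (Fin 2) ℝ)} {k : ℤ} {g : CuspForm Γ k} {p : ℕ} [Fact p.Prime]
  (ι : coeffField g →+* PadicAlgCl p) [FiniteDimensional ℚ_[p] (padicCoeffField ι)]

/-- **`𝒪/p^j𝒪` is finite** for `𝒪 = padicCoeffIntegers ι` (`𝒪` is a finitely generated `ℤ_p`-module and `ℤ_p/p^j` is finite).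
[cite: NeukirchANT1999, Ch. II (6.8) with (4.8)] -/
theorem finite_padicCoeffIntegers_quotient_pow (j : ℕ) :
    Finite (padicCoeffIntegers ι ⧸ Ideal.span {(p : padicCoeffIntegers ι) ^ j}) := by
  haveI := moduleFinite_padicCoeffIntegers ι
  haveI := finite_padicInt_quotient_pow p j
  have h := finite_quotient_span_algebraMap2 (R := ℤ_[p]) (𝒪 := padicCoeffIntegers ι) ((p : ℤ_[p]) ^ j)
  rwa [map_pow, map_natCast] at h

/-- **`𝒪/c𝒪` is finite for every `c ≠ 0`** in `𝒪 = padicCoeffIntegers ι`: some `p^j` lies in `c𝒪` (`p^j c⁻¹ ∈ 𝒪` for large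
`j`, `exists_pow_p_mul_mem_padicCoeffIntegers`), so `𝒪/c` is a quotient of the finite `𝒪/p^j`.
[cite: NeukirchANT1999, Ch. II (4.8) (the valuation ring of a finite extension of ℚ_p)] -/
theorem finite_padicCoeffIntegers_quotient_span (c : padicCoeffIntegers ι)
    (hc : (c : padicCoeffField ι) ≠ 0) :
    Finite (padicCoeffIntegers ι ⧸ Ideal.span {c}) := by
  obtain ⟨j, y, hy⟩ := exists_pow_p_mul_mem_padicCoeffIntegers ι ((c : padicCoeffField ι)⁻¹)
  have hpj : (p : padicCoeffIntegers ι) ^ j = c * y := by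
    apply Subtype.ext
    have hy' : (y : padicCoeffField ι) = (p : padicCoeffField ι) ^ j * (c : padicCoeffField ι)⁻¹ := hy
    change (((p : padicCoeffIntegers ι) ^ j : padicCoeffIntegers ι) : padicCoeffField ι) =
      (c : padicCoeffField ι) * (y : padicCoeffField ι)
    rw [hy', mul_left_comm, mul_inv_cancel₀ hc, mul_one]
    simp
  have hle : Ideal.span {(p : padicCoeffIntegers ι) ^ j} ≤ Ideal.span {c} := by
    rw [Ideal.span_singleton_le_span_singleton, hpj]
    exact Dvd.intro y rfl
  haveI := finite_padicCoeffIntegers_quotient_pow ι j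
  exact Finite.of_surjective _ (Ideal.Quotient.factor_surjective hle)

end Padic

end Literature.NumberTheory.EllipticCurves.GreenbergSelmer

end
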